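import Summits.HodgeConjecture.HodgeConjecture.Cruxes.BlochSeedDiscOne.SeedChecker
import Summits.HodgeConjecture.HodgeConjecture.Cruxes.BlochSeedDiscOne.MonadAlphabet
import HarnessLib

/-!
# Seed checker v24 — THE ALPHABET ADAPTER: designs over ANY cell alphabet with an integer shadow (box semi-homogeneous letters at
scale `L`, unipotent letters, the integer letters) feed the v4 doors; frames READ AT SCALE `L` (hsemireg-c5c8-1 g23, 2026-08-30)

Crux of record `Summit.HodgeConjecture.HodgeConjecture.Theses.EightfoldBlochSeeds.BlochSeedDiscOne` (item stmt-HodgeConjecture-18881;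
line token `Lines/birth.lean` 814a6a70c14e831a `stub_rung_pad4_seedAt` — positive side: ONE (A1)-clean design with `μ ≠ 0` realised by a
vector bundle = a SEED). ADDITIVE to the BUILT v4 `SeedChecker.lean` and to typer-3's `MonadAlphabet.lean` (both importable on the farm
snapshot; the satellites v5–v23 are not built and are NOT imported). No declaration of either file is changed.

HONEST FRAMING. A TYPING SPEC: predicates, dictionaries and repackaging theorems. Nothing is proved toward HC ∕ HC_CM ∕ HC_AV ∕ №4 ∕
26512 ∕ 18881 ∕ H2; no bundle, monad, sheaf, section or zero scheme is constructed; the doors stay hypothesis-carrying. Evidence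
and a typed file, not a rung.

THE GAP THIS FILE CLOSES. The checker's json side (v1–v23: `Design` = 𝔅(μ₄) INTEGER line-bundle cells with integer multiplicities)
is hard-wired to the integer alphabet, while the forest now searches NEW ALPHABETS typed generically in `MonadAlphabet.lean`
(`CellAlphabet`, `Presentation 𝔠`, `MonadDesign 𝔠`; the BOX semi-homogeneous alphabet `boxAlphabet L` = rational slopes written at
a common scale `L` with rank weights, the UNIPOTENT alphabet, isogeny letters ↦ box letters). For those alphabets «a seed checker
exists before a candidate does» was false: no door accepted a `Presentation (boxAlphabet L)`. Two facts make the adapter short: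

* (json side) **INTEGER SHADOWS** (§24.2). Each alphabet of record has a class map to integer cells with a natural weight —
  `ch(X) = wt(X) · ch(pt(X))`: box letters `rk · bphi(numerator at scale L)` (`IntShadow.box`), unipotent letters `m · bphi(pt)`
  (`IntShadow.unip`, = `cellCh_unip`), integer letters themselves (`IntShadow.ofB`). Pushing a presentation ∕ monad design forward
  along the shadow (cells ↦ `pt`, multiplicities ↦ fibre sums of `m · wt`) gives a v4 `Design` WITH THE SAME CLASS TENSOR
  (`IntShadow.wch_design`, `IntShadow.wch_designM`) — hence the same C0 data (`Clean`, `μ`, rank = `ch₀`, positivity: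
  `IntShadow.clean_design_iff`, `mu_design`, `rank_design`, `classData_design`). CLASS-LEVEL ONLY: a box cell is not `rkw` copies of a
  line bundle (maps, `Live`, `hom`, Hall data differ and stay the alphabet's); but class level is all the json side of C0–C8 reads.
  Consequence (FLAG): every class-level screen or kill proved for integer designs — (A1), `μ`, the (R_r) Newton closure of v23, the
  rank wall, K-μ32-type congruences — applies VERBATIM to box-semihomogeneous ∕ unipotent designs through their shadow; the new
  alphabets add nothing at class level except that supports move to the DILATED lattice (line `h` ↦ line `h·L`) and multiplicities
  come weighted.
* (object side) **FRAMES READ AT SCALE `L`** (§24.1, §24.3). A design written at scale `L` names `L^p · ch_p` of the object, i.e.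
  the object realises the RATIONAL tensor `D_{1∕L} T`. Rather than leave `ℤ[i]`, rescale the frames: `WordFrame.rescale q`
  (`cls_p ↦ q^p · cls_p`), `WeilFrame.smulQ c` (`r_i ↦ c · r_i`, still rational, in the Weil plane, independent), the kit
  `AnchorKit.smulW` (only the Weil frame changes; `η`, the polarisation datum and O-hyp are untouched — NO new obligation), and
  `LinksTo.rescale`: a word frame linked to `(F, h)` rescales to one linked to `(F.smulQ q⁴, q · h)`. Then
  `RealisesTensorAtScale C Φ 𝓕 L T` («`L^p · ch_p(𝓕) = classOf_p T`») IS v4's `RealisesTensor` in the frame rescaled by `q = 1∕L`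
  (`realisesTensor_atScale_iff`), so v4's collapse `Design.realisedBy_of_realisesTensor` and every v4 door apply UNCHANGED to the
  shadow design, with the kit `K.atScale L` whose Weil class is `wOf μ ∕ L⁴` (`WeilFrame.wOf_atScale`) — rational, in the Weil
  plane, non-zero iff `μ ≠ 0`: (pad4)-compatibility of the scale is FREE, (σ)'s design half is `μ_L = L⁴·μ ≠ 0` (scale-invariant,
  `degScale_eWord`), (d = 1) stays in the types, (A1@Z) ⟸ (A1) + realisation as before (`cleanAtSeed_smul` moves `h∕L` back to `h_std`).
  END-TO-END: `Design.hasHyperbolicBFSheafSeedOn_atScale` (sheaf door, H2 reading) and `Design.seedCheck_atScale_of_zeroScheme` (lci ∕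
  Bloch door, given v4's `TopChernFourLocalisation` law) from a realisation at scale `L`; `IntShadow.hasHyperbolicBFSheafSeedOn` ∕
  `hasHyperbolicBFSheafSeedOn_of_boxPresentation` ∕ `…_of_boxMonadDesign` ∕ `…_of_unipPresentation` ∕ `seedCheck_of_boxPresentation_zeroScheme`
  are the checkers for the new alphabets BY NAME; §24.4 serves every TAME alphabet (incl. `gAlph`) at tensor level.

FLAGS (what is vacuous ∕ implied ∕ not covered). (i) `rank = count` only on UNITAL alphabets (`MonadAlphabet.rank_eq_count`); for box
designs the rank is `Σ m · rkw` (`IntShadow.rank_design` + `BoxCell.cellCh_oneWord`) — C0's «rank 4» must be read on `ch₀`, not on the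
copy count. (ii) Integrality of the shadow's coefficients and `μ̄ = conj μ` are automatic (it is an integer design: v4
`Design.mubar_eq_star_mu`). (iii) Alphabets with NO integer shadow on the box frame — the unbalanced letters `gAlph` (`α ≠ α′`; blocks B3 ∕ B4) — are
served by the TENSOR-LEVEL collapse of §24.4 (`cleanAtSeed_of_realisesTensor_tame`: (A1) + TAME (real e-free coefficients,
`T(ēēēē) = conj T(eeee)` — automatic on every alphabet of record, `cellTame_gAlph` &c., a genuine json check in general) + realisation ⟹
(A1@Z)), with the sheaf door `hasHyperbolicBFSheafSeedOn_of_tamePresentation` ∕ `_of_gPresentation` and the (σ) object half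
`classCheck_of_tamePresentation_zeroScheme` (kit-level, design-free). NOT COVERED: the NON-BOX alphabet on the compound frame `XWord`
(`MonadAlphabet.nonboxAlphabet`): no word-frame dictionary for `XWord` exists in the tree (obligation O-WF for `XWord` first). (iv) (R_r) at scale `L`: apply v23 `newtonClosed_of_realisedBy` to the
realisation in the rescaled frame (`Design.realisedBy_atScale`); its kit hypotheses (`HPrimitive`, `FrameGram γ`, `h⁸ ≠ 0`) are
rescaling-invariant by bilinearity (`γ` unchanged) — one-liners once v23 is built on the farm; so the (R4) screen of a box ∕ unipotent
design is v23's DECIDABLE `NewtonClosed (σ.design Pr) 4 2` on its shadow. (v) Object-side semiregularity is untouched by all of this.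

No `instance`, no `notation`, no named fact, 0 `sorry`; census-neutral. Sources: v4 `SeedChecker.lean` (g0–g3), `MonadAlphabet.lean`
(typer-3; semihom-1 SEMIHOM-ALPHABET-LINE14 f4334e64, SPEC-BOX-SEMIHOM-LINE14; alphabet-unipotent-1 SPEC-UNIPOTENT-LINE), director R19.162
(denominator clearing), card `birth-v4.md` rows W36∕W37; Mukai 1978 (semi-homogeneous bundles, `ch = rk·e^{δ}`); Buchweitz–Flenner 2003
(semiregularity map); Fulton 1998 §14.1 ∕ Thm 3.2.
-/

set_option linter.dupNamespace false

open CategoryTheory AlgebraicGeometry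
open Literature.AlgebraicGeometry Literature.AlgebraicGeometry.Motives Literature.AlgebraicGeometry.HodgeTheory
open Literature.AlgebraicTopology.SingularHomology

noncomputable section

namespace Summit.HodgeConjecture.HodgeConjecture.Cruxes.BlochSeedDiscOne.SeedChecker

open Summit.HodgeConjecture.HodgeConjecture.Cruxes.BlochSeedDiscOne.Anchor
open Summit.Ventures.HSemireg Summit.Ventures.HSemireg.Pad4Tower

/-! ## §24.1 Frames read at scale: rational rescaling of the Weil frame, the kit and the word frame -/

section Rescale

/-- `(c • x)ⁱ = cⁱ • xⁱ` (bilinearity of `∪`; the tree's copies of this lemma are `private`). [cite: HatcherAT2002, §3.2] -/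
theorem cupPowTwo_smul_pow {Y : Type} [TopologicalSpace Y] (c : ℂ) (x : singularCohomology ℂ ℂ Y 2) (i : ℕ) :
    cupPowTwo (c • x) i = c ^ i • cupPowTwo x i := by
  induction i with
  | zero => rw [cupPowTwo_zero, cupPowTwo_zero, pow_zero, one_smul]
  | succ i ih =>
    rw [cupPowTwo_succ, cupPowTwo_succ, ih]
    simp only [map_smul, LinearMap.smul_apply, smul_smul, pow_succ, mul_comm]

variable {E₀ : AbelianVariety ℂ} {ψ₀ : E₀ ⟶ E₀}

/-- **RATIONAL RESCALING OF A WEIL FRAME**: `(r₁, r₂) ↦ (c·r₁, c·r₂)`, `c ∈ ℚˣ` — still rational, in the Weil plane, `ℂ`-independent.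
No new obligation: it is built from the given frame. -/
def WeilFrame.smulQ (F : WeilFrame E₀ ψ₀) (c : ℚ) (hc : c ≠ 0) : WeilFrame E₀ ψ₀ where
  rOne := ((c : ℚ) : ℂ) • F.rOne
  rTwo := ((c : ℚ) : ℂ) • F.rTwo
  rOne_rational := F.rOne_rational.smul c
  rTwo_rational := F.rTwo_rational.smul c
  rOne_mem := Submodule.smul_mem _ _ F.rOne_mem
  rTwo_mem := Submodule.smul_mem _ _ F.rTwo_mem
  indep s t hst := by
    have hc' : ((c : ℚ) : ℂ) ≠ 0 := by exact_mod_cast hc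
    rw [smul_smul, smul_smul] at hst
    obtain ⟨hs, ht⟩ := F.indep _ _ hst
    exact ⟨(mul_eq_zero.1 hs).resolve_right hc', (mul_eq_zero.1 ht).resolve_right hc'⟩

@[simp] theorem WeilFrame.smulQ_rOne (F : WeilFrame E₀ ψ₀) (c : ℚ) (hc : c ≠ 0) :
    (F.smulQ c hc).rOne = ((c : ℚ) : ℂ) • F.rOne := rfl

@[simp] theorem WeilFrame.smulQ_rTwo (F : WeilFrame E₀ ψ₀) (c : ℚ) (hc : c ≠ 0) :
    (F.smulQ c hc).rTwo = ((c : ℚ) : ℂ) • F.rTwo := rfl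

/-- **the Weil class read in the rescaled frame is the rescaled Weil class**: `wOf' μ = c · wOf μ`. -/
theorem WeilFrame.wOf_smulQ (F : WeilFrame E₀ ψ₀) (c : ℚ) (hc : c ≠ 0) (μ : GaussianInt) :
    (F.smulQ c hc).wOf μ = ((c : ℚ) : ℂ) • F.wOf μ := by
  simp only [WeilFrame.wOf, WeilFrame.smulQ_rOne, WeilFrame.smulQ_rTwo]
  module

/-- **THE KIT WITH ITS WEIL FRAME RESCALED** (`η`, the polarisation datum O-pol and O-hyp untouched). -/
def AnchorKit.smulW (K : AnchorKit E₀ ψ₀) (c : ℚ) (hc : c ≠ 0) : AnchorKit E₀ ψ₀ :=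
  { K with F := K.F.smulQ c hc }

@[simp] theorem AnchorKit.smulW_F (K : AnchorKit E₀ ψ₀) (c : ℚ) (hc : c ≠ 0) : (K.smulW c hc).F = K.F.smulQ c hc := rfl

@[simp] theorem AnchorKit.smulW_η (K : AnchorKit E₀ ψ₀) (c : ℚ) (hc : c ≠ 0) : (K.smulW c hc).η = K.η := rfl

@[simp] theorem AnchorKit.smulW_pol (K : AnchorKit E₀ ψ₀) (c : ℚ) (hc : c ≠ 0) : (K.smulW c hc).pol = K.pol := rfl

/-- (σ) read on the rescaled kit: the supported class is `q·h_K⁴ + c·wOf μ`. -/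
theorem classCheck_smulW_iff (K : AnchorKit E₀ ψ₀) (c : ℚ) (hc : c ≠ 0) (μ : GaussianInt) {Z : Scheme.{0}}
    (i : Z ⟶ (pad4Anchor E₀).X.left) (q : ℚ) :
    ClassCheck (K.smulW c hc) μ i q ↔ μ ≠ 0 ∧
      ((q : ℚ) : ℂ) • cupPowTwo (symH (pad4Action E₀ ψ₀) K.pol.e K.pol.a) 4 + ((c : ℚ) : ℂ) • K.F.wOf μ ∈
        classesSupportedOn (pad4Anchor E₀).X (Set.range i.base) (2 * 4) := by
  rw [ClassCheck, AnchorKit.smulW_F, WeilFrame.wOf_smulQ]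
  exact Iff.rfl

/-- **THE WORD FRAME RESCALED BY `q ∈ ℚ`**: `cls_p(w) ↦ q^p · cls_p(w)` (the frame of `q·h`: every letter class of degree `d` scales
by `q^d`). -/
def WordFrame.rescale (Φ : WordFrame E₀) (q : ℚ) : WordFrame E₀ :=
  ⟨fun p w => (((q : ℚ) : ℂ) ^ p) • Φ.cls p w⟩

@[simp] theorem WordFrame.rescale_cls (Φ : WordFrame E₀) (q : ℚ) (p : ℕ) (w : CWord) :
    (Φ.rescale q).cls p w = (((q : ℚ) : ℂ) ^ p) • Φ.cls p w := rfl

/-- the class a tensor names in the rescaled frame is `q^p ·` the class it names. -/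
theorem WordFrame.classOf_rescale (Φ : WordFrame E₀) (q : ℚ) (p : ℕ) (T : CWord → GaussianInt) :
    (Φ.rescale q).classOf p T = (((q : ℚ) : ℂ) ^ p) • Φ.classOf p T := by
  rw [WordFrame.classOf_apply, WordFrame.classOf_apply, Finset.smul_sum]
  exact Finset.sum_congr rfl fun w _ => by rw [WordFrame.rescale_cls, smul_comm]

/-- **RESCALING PRESERVES THE LINK**: a word frame linked to `(F, h)` rescales to one linked to `(F·q⁴, q·h)` ((F1): `(q h)^p ∕ p!` is the
sum of the rescaled e-free words; (F2): `q⁴ r₁ = cls'₄ eeee + cls'₄ ēēēē`, same for `r₂`). -/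
theorem WordFrame.LinksTo.rescale {Φ : WordFrame E₀} {F : WeilFrame E₀ ψ₀} {h : complexBetti (pad4Anchor E₀).X 2}
    (hΦ : Φ.LinksTo F h) {q : ℚ} (hq : q ≠ 0) :
    (Φ.rescale q).LinksTo (F.smulQ (q ^ 4) (pow_ne_zero 4 hq)) (((q : ℚ) : ℂ) • h) where
  sum_eFree p := by
    simp only [WordFrame.rescale_cls]
    rw [← Finset.smul_sum, hΦ.sum_eFree p, cupPowTwo_smul_pow, smul_comm]
  rOne_eq := by
    simp only [WeilFrame.smulQ_rOne, WordFrame.rescale_cls, hΦ.rOne_eq, smul_add, Rat.cast_pow]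
  rTwo_eq := by
    simp only [WeilFrame.smulQ_rTwo, WordFrame.rescale_cls, hΦ.rTwo_eq, Rat.cast_pow, smul_sub,
      smul_comm ((((q : ℚ) : ℂ)) ^ 4) Complex.I]

/-- the class of a DEGREE-SCALED tensor (`MonadAlphabet.degScale`: `T ↦ s^{deg w}·T(w)`, the integer design read at scale `s`) is
`s^p ·` the class of the tensor. -/
theorem WordFrame.classOf_degScale (Φ : WordFrame E₀) (p : ℕ) (s : GaussianInt) (T : CWord → GaussianInt) :
    Φ.classOf p (MonadAlphabet.degScale s T) = (GaussianInt.toComplex s ^ p) • Φ.classOf p T := by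
  rw [WordFrame.classOf_apply, WordFrame.classOf_apply, Finset.smul_sum]
  refine Finset.sum_congr rfl fun w hw => ?_
  rw [mem_wordsOfDeg] at hw
  simp only [MonadAlphabet.degScale, map_mul, map_pow, hw, mul_smul]

variable {C : ChernCharacterBetti} {Φ : WordFrame E₀}

/-- **«THE SHEAF `𝓕` REALISES THE TENSOR `T` AT SCALE `L`»**: `L^p · ch_p(𝓕) = Σ_{wdeg w = p} T(w)·cls_p(w)`, `p ≤ 8` — the
dictionary sentence for a design WRITTEN AT SCALE `L` (box semi-homogeneous letters with denominators dividing `L`: the design tensor is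
the degree scaling `D_L` of the rational tensor `ch(𝓕)` names). At `L = 1` it is v4's `RealisesTensor`. -/
def RealisesTensorAtScale (C : ChernCharacterBetti) (Φ : WordFrame E₀) (𝓕 : (pad4Anchor E₀).X.left.Modules) (L : ℕ)
    (T : CWord → GaussianInt) : Prop :=
  ∀ p : Fin 9, ((L : ℂ) ^ (p : ℕ)) • C.ch (pad4Anchor E₀).X 𝓕 p = Φ.classOf p T

theorem realisesTensorAtScale_one_iff {𝓕 : (pad4Anchor E₀).X.left.Modules} {T : CWord → GaussianInt} :
    RealisesTensorAtScale C Φ 𝓕 1 T ↔ RealisesTensor C Φ 𝓕 T := by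
  simp only [RealisesTensorAtScale, RealisesTensor, Nat.cast_one, one_pow, one_smul]

/-- the inverse scale `1 ∕ L`. -/
def invScale (L : ℕ) : ℚ := (1 : ℚ) / L

theorem invScale_ne_zero {L : ℕ} (hL : L ≠ 0) : invScale L ≠ 0 :=
  one_div_ne_zero (Nat.cast_ne_zero.2 hL)

theorem cast_invScale_mul {L : ℕ} (hL : L ≠ 0) : (L : ℂ) * ((invScale L : ℚ) : ℂ) = 1 := by
  rw [invScale, Rat.cast_div, Rat.cast_one, Rat.cast_natCast, mul_one_div_cancel (Nat.cast_ne_zero.2 hL)]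

theorem natCast_mul_invScale {L : ℕ} (hL : L ≠ 0) : (L : ℚ) * invScale L = 1 := by
  rw [invScale, mul_one_div_cancel (Nat.cast_ne_zero.2 hL)]

/-- **THE WORD FRAME READ AT SCALE `L`** = the frame rescaled by `1 ∕ L`. -/
def WordFrame.atScale (Φ : WordFrame E₀) (L : ℕ) : WordFrame E₀ := Φ.rescale (invScale L)

/-- **THE WEIL FRAME READ AT SCALE `L`**: `r_i ↦ r_i ∕ L⁴`. -/
def WeilFrame.atScale (F : WeilFrame E₀ ψ₀) (L : ℕ) (hL : L ≠ 0) : WeilFrame E₀ ψ₀ :=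
  F.smulQ (invScale L ^ 4) (pow_ne_zero 4 (invScale_ne_zero hL))

/-- **THE KIT READ AT SCALE `L`** (Weil frame `∕ L⁴`; everything else as given). -/
def AnchorKit.atScale (K : AnchorKit E₀ ψ₀) (L : ℕ) (hL : L ≠ 0) : AnchorKit E₀ ψ₀ :=
  K.smulW (invScale L ^ 4) (pow_ne_zero 4 (invScale_ne_zero hL))

@[simp] theorem AnchorKit.atScale_F (K : AnchorKit E₀ ψ₀) (L : ℕ) (hL : L ≠ 0) : (K.atScale L hL).F = K.F.atScale L hL := rfl

@[simp] theorem AnchorKit.atScale_η (K : AnchorKit E₀ ψ₀) (L : ℕ) (hL : L ≠ 0) : (K.atScale L hL).η = K.η := rfl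

@[simp] theorem AnchorKit.atScale_pol (K : AnchorKit E₀ ψ₀) (L : ℕ) (hL : L ≠ 0) : (K.atScale L hL).pol = K.pol := rfl

/-- **the Weil class at scale `L` is `wOf μ ∕ L⁴`** — rational, in the Weil plane, and non-zero iff `μ ≠ 0` (the `WeilFrame` API of the
rescaled frame): writing designs at a scale costs nothing on the (σ) ∕ (pad4) side. -/
theorem WeilFrame.wOf_atScale (F : WeilFrame E₀ ψ₀) (L : ℕ) (hL : L ≠ 0) (μ : GaussianInt) :
    (F.atScale L hL).wOf μ = (((invScale L ^ 4 : ℚ)) : ℂ) • F.wOf μ :=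
  F.wOf_smulQ _ _ μ

/-- the frame read at scale `L` is linked to `(F ∕ L⁴, h ∕ L)`. -/
theorem WordFrame.LinksTo.atScale {Φ : WordFrame E₀} {F : WeilFrame E₀ ψ₀} {h : complexBetti (pad4Anchor E₀).X 2}
    (hΦ : Φ.LinksTo F h) {L : ℕ} (hL : L ≠ 0) :
    (Φ.atScale L).LinksTo (F.atScale L hL) (((invScale L : ℚ) : ℂ) • h) :=
  hΦ.rescale (invScale_ne_zero hL)

/-- **REALISATION AT SCALE `L` IS v4's REALISATION IN THE FRAME READ AT SCALE `L`.** -/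
theorem realisesTensor_atScale_iff {𝓕 : (pad4Anchor E₀).X.left.Modules} {T : CWord → GaussianInt} {L : ℕ} (hL : L ≠ 0) :
    RealisesTensor C (Φ.atScale L) 𝓕 T ↔ RealisesTensorAtScale C Φ 𝓕 L T := by
  have hL' : (L : ℂ) ≠ 0 := Nat.cast_ne_zero.2 hL
  have hq : ((invScale L : ℚ) : ℂ) = (L : ℂ)⁻¹ := by
    rw [invScale, Rat.cast_div, Rat.cast_one, Rat.cast_natCast, one_div]
  refine forall_congr' fun p => ?_
  rw [WordFrame.atScale, WordFrame.classOf_rescale, hq, inv_pow]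
  constructor
  · intro h
    rw [h, smul_smul, mul_inv_cancel₀ (pow_ne_zero _ hL'), one_smul]
  · intro h
    rw [← h, smul_smul, inv_mul_cancel₀ (pow_ne_zero _ hL'), one_smul]

/-- **CONSISTENCY WITH THE INTEGER EMBEDDING**: a sheaf realising `T` realises the degree-scaled tensor `D_L T` at scale `L` (the
integer design read at scale `L`, `BoxCell.cellCh_ofMCell`). -/
theorem RealisesTensor.atScale_degScale {𝓕 : (pad4Anchor E₀).X.left.Modules} {T : CWord → GaussianInt}
    (hT : RealisesTensor C Φ 𝓕 T) (L : ℕ) :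
    RealisesTensorAtScale C Φ 𝓕 L (MonadAlphabet.degScale ((L : ℤ) : GaussianInt) T) := fun p => by
  rw [WordFrame.classOf_degScale, ← hT p, map_intCast, Int.cast_natCast]

/-- isomorphic sheaves realise the same tensor at the same scale. -/
theorem RealisesTensorAtScale.congr_iso {𝓕 𝓕' : (pad4Anchor E₀).X.left.Modules} {L : ℕ} {T : CWord → GaussianInt}
    (hT : RealisesTensorAtScale C Φ 𝓕 L T) (e : 𝓕 ≅ 𝓕') : RealisesTensorAtScale C Φ 𝓕' L T :=
  fun p => by rw [← C.ch_congr e p]; exact hT p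

end Rescale

/-! ## §24.2 Integer shadows: designs over a cell alphabet pushed forward to v4 `Design`s with the same class tensor -/

section Shadow

variable {𝔠 : MonadAlphabet.CellAlphabet GaussianInt CWord}

/-- **AN INTEGER SHADOW of a cell alphabet** (balanced frame): a map `pt` to integer 𝔅(μ₄) cells and a positive weight `wt` with
`ch(X) = wt(X) · ch(pt X)` for every cell. DATA; the three alphabets of record carry one (`IntShadow.ofB`, `.box`, `.unip` below). -/
structure IntShadow (𝔠 : MonadAlphabet.CellAlphabet GaussianInt CWord) where
  /-- the integer cell a cell shadows -/
  pt : 𝔠.Cell → MCell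
  /-- its weight (rank weight, multiplicity, …) -/
  wt : 𝔠.Cell → ℕ
  wt_pos : ∀ X, 0 < wt X
  /-- `ch(X) = wt(X) · ch(pt X)` -/
  ch_eq : ∀ X, 𝔠.ch X = (wt X : ℤ) • (pt X).ch

namespace IntShadow

variable (σ : IntShadow 𝔠)

/-- the multiplicity an integer cell `Z` receives from the cells of `S` shadowing it: `Σ_{X ∈ S, pt X = Z} m(X)·wt(X)`. -/
def fibreMult (S : Finset 𝔠.Cell) (m : 𝔠.Cell → ℤ) (Z : MCell) : ℤ :=
  ∑ X ∈ S with σ.pt X = Z, m X * σ.wt X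

theorem fibreMult_eq_zero {S : Finset 𝔠.Cell} {m : 𝔠.Cell → ℤ} {Z : MCell} (hZ : Z ∉ S.image σ.pt) :
    σ.fibreMult S m Z = 0 :=
  Finset.sum_eq_zero fun X hX => by
    obtain ⟨hXS, hXZ⟩ := Finset.mem_filter.1 hX
    exact absurd (hXZ ▸ Finset.mem_image_of_mem σ.pt hXS) hZ

theorem fibreMult_pos {S : Finset 𝔠.Cell} {m : 𝔠.Cell → ℤ} (hm : ∀ X ∈ S, 0 < m X) {Z : MCell} (hZ : Z ∈ S.image σ.pt) :
    0 < σ.fibreMult S m Z := by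
  obtain ⟨X, hXS, hXZ⟩ := Finset.mem_image.1 hZ
  refine Finset.sum_pos (fun Y hY => ?_) ⟨X, Finset.mem_filter.2 ⟨hXS, hXZ⟩⟩
  exact mul_pos (hm Y (Finset.mem_filter.1 hY).1) (by exact_mod_cast σ.wt_pos Y)

/-- **THE PUSH-FORWARD IS CLASS-EXACT**: `Σ_{Z ∈ pt(S)} fibreMult(Z) · ch(Z) = Σ_{X ∈ S} m(X) · ch(X)`. -/
theorem sum_fibreMult_smul (S : Finset 𝔠.Cell) (m : 𝔠.Cell → ℤ) :
    ∑ Z ∈ S.image σ.pt, σ.fibreMult S m Z • Z.ch = ∑ X ∈ S, m X • 𝔠.ch X := by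
  calc ∑ Z ∈ S.image σ.pt, σ.fibreMult S m Z • Z.ch
      = ∑ Z ∈ S.image σ.pt, ∑ X ∈ S with σ.pt X = Z, (m X * σ.wt X) • Z.ch :=
        Finset.sum_congr rfl fun Z _ => by rw [fibreMult, Finset.sum_smul]
    _ = ∑ Z ∈ S.image σ.pt, ∑ X ∈ S with σ.pt X = Z, (m X * σ.wt X) • (σ.pt X).ch :=
        Finset.sum_congr rfl fun Z _ => Finset.sum_congr rfl fun X hX => by rw [(Finset.mem_filter.1 hX).2]
    _ = ∑ X ∈ S, (m X * σ.wt X) • (σ.pt X).ch :=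
        Finset.sum_fiberwise_of_maps_to (fun X hX => Finset.mem_image_of_mem σ.pt hX) _
    _ = ∑ X ∈ S, m X • 𝔠.ch X := Finset.sum_congr rfl fun X _ => by rw [σ.ch_eq X, smul_smul]

/-- **THE SHADOW DESIGN of a two-term presentation** over `𝔠`: cells `pt(N)`, `pt(P)` with the fibre multiplicities. -/
def design (Pr : MonadAlphabet.Presentation 𝔠) : Design :=
  ⟨⟨Pr.N.image σ.pt, Pr.P.image σ.pt⟩, σ.fibreMult Pr.N Pr.mN, σ.fibreMult Pr.P Pr.mP⟩

/-- **… HAS THE PRESENTATION'S CLASS TENSOR.** -/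
theorem wch_design (Pr : MonadAlphabet.Presentation 𝔠) : (σ.design Pr).wch = Pr.wch := by
  simp only [Design.wch, MConfig.wch, design, MonadAlphabet.Presentation.wch, sum_fibreMult_smul]

theorem clean_design_iff (Pr : MonadAlphabet.Presentation 𝔠) : (σ.design Pr).Clean ↔ Pr.Clean := by
  rw [Design.Clean, wch_design]; exact Iff.rfl

theorem mu_design (Pr : MonadAlphabet.Presentation 𝔠) : (σ.design Pr).mu = Pr.mu := by
  rw [Design.mu, wch_design]; rfl

/-- the shadow's rank is `ch₀` of the presentation (NOT its copy count unless the alphabet is unital). -/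
theorem rank_design (Pr : MonadAlphabet.Presentation 𝔠) : (σ.design Pr).rank = Pr.wch MonadAlphabet.oneWord := by
  rw [Design.rank, wch_design]; rfl

theorem positive_design {Pr : MonadAlphabet.Presentation 𝔠} (hN : ∀ X ∈ Pr.N, 0 < Pr.mN X) (hP : ∀ X ∈ Pr.P, 0 < Pr.mP X) :
    (σ.design Pr).Positive :=
  ⟨fun _ hZ => σ.fibreMult_pos hN hZ, fun _ hZ => σ.fibreMult_pos hP hZ⟩

/-- **C0 TRANSFERS**: clean, `μ ≠ 0`, `ch₀ = 4`, positive multiplicities ⟹ the shadow design passes v4's `ClassData`. -/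
theorem classData_design {Pr : MonadAlphabet.Presentation 𝔠} (hclean : Pr.Clean) (hμ : Pr.mu ≠ 0)
    (hrk : Pr.wch MonadAlphabet.oneWord = 4) (hN : ∀ X ∈ Pr.N, 0 < Pr.mN X) (hP : ∀ X ∈ Pr.P, 0 < Pr.mP X) :
    (σ.design Pr).ClassData :=
  ⟨(σ.clean_design_iff Pr).2 hclean, by rwa [σ.mu_design], by rw [σ.rank_design, hrk], σ.positive_design hN hP⟩

/-- C0′ (rank-free) transfers. -/
theorem classDataRankFree_design {Pr : MonadAlphabet.Presentation 𝔠} (hclean : Pr.Clean) (hμ : Pr.mu ≠ 0) :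
    (σ.design Pr).ClassDataRankFree :=
  ⟨(σ.clean_design_iff Pr).2 hclean, by rwa [σ.mu_design]⟩

/-- **THE SHADOW DESIGN of a three-term MONAD design** (`N − A − C`): `A`- and `C`-cells both go to the `P`-side. -/
def designM (D : MonadAlphabet.MonadDesign 𝔠) : Design :=
  ⟨⟨D.N.image σ.pt, D.A.image σ.pt ∪ D.C.image σ.pt⟩, σ.fibreMult D.N D.mN,
    fun Z => σ.fibreMult D.A D.mA Z + σ.fibreMult D.C D.mC Z⟩

/-- **… HAS THE MONAD DESIGN'S CLASS TENSOR `N − A − C`.** -/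
theorem wch_designM (D : MonadAlphabet.MonadDesign 𝔠) : (σ.designM D).wch = D.wch := by
  have hA : ∑ Z ∈ D.A.image σ.pt ∪ D.C.image σ.pt, σ.fibreMult D.A D.mA Z • Z.ch = ∑ X ∈ D.A, D.mA X • 𝔠.ch X := by
    rw [← σ.sum_fibreMult_smul]
    refine (Finset.sum_subset Finset.subset_union_left fun Z _ hZ => ?_).symm
    rw [σ.fibreMult_eq_zero hZ, zero_smul]
  have hC : ∑ Z ∈ D.A.image σ.pt ∪ D.C.image σ.pt, σ.fibreMult D.C D.mC Z • Z.ch = ∑ X ∈ D.C, D.mC X • 𝔠.ch X := by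
    rw [← σ.sum_fibreMult_smul]
    refine (Finset.sum_subset Finset.subset_union_right fun Z _ hZ => ?_).symm
    rw [σ.fibreMult_eq_zero hZ, zero_smul]
  simp only [Design.wch, MConfig.wch, designM, MonadAlphabet.MonadDesign.wch, add_smul, Finset.sum_add_distrib, hA, hC,
    sum_fibreMult_smul, sub_sub]

theorem clean_designM_iff (D : MonadAlphabet.MonadDesign 𝔠) : (σ.designM D).Clean ↔ D.Clean := by
  rw [Design.Clean, wch_designM]; exact Iff.rfl

theorem mu_designM (D : MonadAlphabet.MonadDesign 𝔠) : (σ.designM D).mu = D.mu := by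
  rw [Design.mu, wch_designM]; rfl

theorem rank_designM (D : MonadAlphabet.MonadDesign 𝔠) : (σ.designM D).rank = D.rank := by
  rw [Design.rank, wch_designM]; rfl

theorem classDataRankFree_designM {D : MonadAlphabet.MonadDesign 𝔠} (hclean : D.Clean) (hμ : D.mu ≠ 0) :
    (σ.designM D).ClassDataRankFree :=
  ⟨(σ.clean_designM_iff D).2 hclean, by rwa [σ.mu_designM]⟩

end IntShadow

/-! ### The three shadows of record -/

/-- the integer alphabet shadows itself (`pt = id`, `wt = 1`). -/
def IntShadow.ofB : IntShadow MonadAlphabet.bAlph where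
  pt Z := Z
  wt _ := 1
  wt_pos _ := Nat.one_pos
  ch_eq Z := by rw [Nat.cast_one, one_smul]; rfl

/-- over the integer alphabet the shadow design is the presentation itself (`Presentation.toMConfig`): same tensor. -/
theorem IntShadow.ofB_wch (Pr : MonadAlphabet.Presentation MonadAlphabet.bAlph) :
    (IntShadow.ofB.design Pr).wch = Pr.toMConfig.wch Pr.mN Pr.mP := by
  rw [IntShadow.wch_design, MonadAlphabet.Presentation.wch_toMConfig]

/-- **THE BOX SEMI-HOMOGENEOUS SHADOW at scale `L`**: a box cell `X = ⊠_f E_{x_f}` shadows the integer cell of its numerators at scale `L`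
with weight its rank weight `Π_f rk_f` — `ch(X) = rkw(X) · ch(numerators at scale L)` (semihom-1 §B `ch(E_x) = rk·e^{δ}`, written at
scale `L`). -/
def IntShadow.box (L : ℕ) : IntShadow (MonadAlphabet.boxAlphabet L) where
  pt X := fun f => (X f).atScale L
  wt X := MonadAlphabet.BoxCell.rkw X
  wt_pos X := Finset.prod_pos fun f _ => (X f).rk.pos
  ch_eq X := by
    funext w
    simp only [Pi.smul_apply, zsmul_eq_mul, MonadAlphabet.BoxCell.rkw, Fin.prod_univ_four, MonadAlphabet.Alphabet.cellCh_apply,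
      MCell.ch, chTensor]
    push_cast
    ring

/-- on integer cells embedded as rank-one box letters the box shadow is the integer cell read at scale `L` (`bscale L`). -/
theorem IntShadow.box_pt_ofMCell (L : ℕ) (Z : MCell) :
    (IntShadow.box L).pt (MonadAlphabet.BoxCell.ofMCell L Z) = fun f => MonadAlphabet.bscale L (Z f) := by
  funext f
  exact MonadAlphabet.SemihomLetter.atScale_ofPt L (Z f)

/-- **THE UNIPOTENT SHADOW**: `ch(X) = (Π_f m_f) · ch(L_X)` (`MonadAlphabet.cellCh_unip`, LEMMA CH). -/
def IntShadow.unip : IntShadow MonadAlphabet.unipAlphabet where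
  pt := MonadAlphabet.UnipLetter.lineCell
  wt := MonadAlphabet.UnipLetter.mult
  wt_pos X := Finset.prod_pos fun f _ => (X f).m.pos
  ch_eq X := by
    funext w
    rw [MonadAlphabet.cellCh_unip, Pi.smul_apply, zsmul_eq_mul, Int.cast_natCast]

end Shadow

/-! ## §24.3 The doors at scale `L` -/

section Doors

variable {E₀ : AbelianVariety ℂ} {ψ₀ : E₀ ⟶ E₀} {C : ChernCharacterBetti}

/-- **THE COLLAPSE AT SCALE `L`**: an (A1)-clean design realised AT SCALE `L` through a word frame linked to `(F, h)` is REALISED (v4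
`Design.RealisedBy`, with its own integer coefficients) against the frame read at scale `L`: `(F ∕ L⁴, h ∕ L)`. -/
theorem Design.realisedBy_atScale {D : Design} {Φ : WordFrame E₀} {F : WeilFrame E₀ ψ₀} {h : complexBetti (pad4Anchor E₀).X 2}
    {𝓔 : (pad4Anchor E₀).X.left.Modules} {L : ℕ} (hL : L ≠ 0) (hΦ : Φ.LinksTo F h) (hD : D.Clean)
    (hR : RealisesTensorAtScale C Φ 𝓔 L D.wch) :
    D.RealisedBy C (F.atScale L hL) (((invScale L : ℚ) : ℂ) • h) 𝓔 :=
  Design.realisedBy_of_realisesTensor (hΦ.atScale hL) hD ((realisesTensor_atScale_iff hL).2 hR)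

/-- **(A1@Z) AGAINST `h` ITSELF** from a realisation at scale `L`: `ℚ[h ∕ L] = ℚ[h]` (`cleanAtSeed_smul`), `W`-coordinate `μ(D)` in the
frame `F ∕ L⁴`. -/
theorem Design.cleanAtSeed_atScale {D : Design} {Φ : WordFrame E₀} {F : WeilFrame E₀ ψ₀} {h : complexBetti (pad4Anchor E₀).X 2}
    {𝓔 : (pad4Anchor E₀).X.left.Modules} {L : ℕ} (hL : L ≠ 0) (hΦ : Φ.LinksTo F h) (hD : D.Clean)
    (hR : RealisesTensorAtScale C Φ 𝓔 L D.wch) {I : Finset ℕ} (hI : ∀ p ∈ I, p ≤ 8) :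
    CleanAtSeed C I (F.atScale L hL) h 𝓔 D.mu := by
  have hcl := cleanAtSeed_smul (cleanAtSeed_of_realisedBy hI (D.realisedBy_atScale hL hΦ hD hR))
    (Nat.cast_ne_zero.2 hL : (L : ℚ) ≠ 0)
  rwa [smul_smul, ← Rat.cast_mul, natCast_mul_invScale hL, Rat.cast_one, one_smul] at hcl

/-- **THE SHEAF DOOR FROM (A1@Z) AGAINST `h_std`, kit-level** (v4 `hasHyperbolicBFSheafSeedOn_of_sheafSeedCheck` with its design
conjunct replaced by what it actually reads: `μ ≠ 0` and `CleanAtSeed`). -/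
theorem hasHyperbolicBFSheafSeedOn_of_cleanAtSeed_hStd (hE : E₀.dim = 1) (hψ : ψ₀ ≫ ψ₀ = -(1 • 𝟙 E₀)) (K : AnchorKit E₀ ψ₀)
    {μ : GaussianInt} (hμ : μ ≠ 0) {I : Finset ℕ} (h4 : 4 ∈ I) {𝓔 : (pad4Anchor E₀).X.left.Modules}
    (h𝓔 : IsFiniteLocallyFree 𝓔) (hsr : IsISemiregular h𝓔 {q' | q' + 1 ∈ I})
    (hcl : CleanAtSeed C I K.F (hStd E₀ K.η) 𝓔 μ) : HasHyperbolicBFSheafSeedOn C 4 1 I :=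
  ⟨pad4Anchor E₀, pad4Action E₀ ψ₀, K.pol.e, K.pol.a, K.F.wOf μ, pad4Anchor_dim hE, pad4Action_comp_self hψ,
    K.pol.a_rational, K.pol.a_ne_zero, K.hyperbolic_symH hE hψ, K.F.wOf_mem _, K.F.wOf_rational _, K.F.wOf_ne_zero hμ,
    hasBFSheafSeedOn_of_cleanAtSeed h𝓔 h4 hsr (cleanAtSeed_symH_of_hStd hE hψ K hcl)⟩

/-- **THE SHEAF DOOR END-TO-END FROM A REALISATION AT SCALE `L`**: an (A1)-clean design with `μ ≠ 0`, realised at scale `L` through the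
word kit by a finite locally free `I`-semiregular `𝓔` (`4 ∈ I ⊆ {0..8}`) gives the tree's `HasHyperbolicBFSheafSeedOn C 4 1 I` — on the kit
READ AT SCALE `L` (Weil class `wOf μ ∕ L⁴`). What remains object-side is exactly what remained at `L = 1`: C5 (locally free), C7
(semiregular), and the realisation. -/
theorem Design.hasHyperbolicBFSheafSeedOn_atScale (hE : E₀.dim = 1) (hψ : ψ₀ ≫ ψ₀ = -(1 • 𝟙 E₀)) (W : WordKit E₀ ψ₀)
    {D : Design} (hD : D.Clean) (hμ : D.mu ≠ 0) {L : ℕ} (hL : L ≠ 0) {𝓔 : (pad4Anchor E₀).X.left.Modules}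
    (hR : RealisesTensorAtScale C W.Φ 𝓔 L D.wch) {I : Finset ℕ} (h4 : 4 ∈ I) (hI : ∀ p ∈ I, p ≤ 8)
    (h𝓔 : IsFiniteLocallyFree 𝓔) (hsr : IsISemiregular h𝓔 {q' | q' + 1 ∈ I}) : HasHyperbolicBFSheafSeedOn C 4 1 I :=
  hasHyperbolicBFSheafSeedOn_of_cleanAtSeed_hStd hE hψ (W.kit.atScale L hL) hμ h4 h𝓔 hsr
    (D.cleanAtSeed_atScale hL W.links hD hR hI)

/-- **THE lci ∕ BLOCH DOOR END-TO-END FROM A ZERO SCHEME, AT SCALE `L`** (v4 `Design.seedCheck_of_zeroScheme` on the kit read at scale `L`,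
GIVEN the law `TopChernFourLocalisation`): `D` passes C0; a rank-`4` vector bundle `𝓕` realises AT SCALE `L` an (A1)-clean design `D'` with
`μ(D') = μ(D)` (e.g. a twist of `D`); a section `s` of `𝓕` has zero scheme `i : Z ↪ S⁴` passing C5, C6, C7 ⟹ `D.SeedCheck (K.atScale L) i q`
for some `q` — hence (`seedData_of_seedCheck`) the conclusion of `stub_rung_pad4_seedAt` on that anchor, with `w = wOf μ(D) ∕ L⁴`. -/
theorem Design.seedCheck_atScale_of_zeroScheme (hE : E₀.dim = 1) (hψ : ψ₀ ≫ ψ₀ = -(1 • 𝟙 E₀)) {D D' : Design}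
    (hC0 : D.ClassData) (hD' : D'.Clean) (hmu : D'.mu = D.mu) (W : WordKit E₀ ψ₀) {L : ℕ} (hL : L ≠ 0)
    {𝓕 : (pad4Anchor E₀).X.left.Modules} (hloc : TopChernFourLocalisation C) (hrk : HasRank 𝓕 4)
    (hR : RealisesTensorAtScale C W.Φ 𝓕 L D'.wch) (s : Modules.unitModule (pad4Anchor E₀).X.left ⟶ 𝓕) {Z : Scheme.{0}}
    {i : Z ⟶ (pad4Anchor E₀).X.left} (hZ : IsZeroSchemeOf s i) (hreg : IsRegularImmersionOfCodim i 4)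
    (hint : AlgebraicGeometry.IsIntegral Z) (hcoh : ∀ z ∈ Set.range i.base, ((4 : ℕ) : ℕ∞) ≤ Order.coheight z)
    (hsr : IsBlochSemiregular i (2 * 4) 4) : ∃ q : ℚ, D.SeedCheck (W.kit.atScale L hL) i q := by
  have hcl : CleanAtSeed C koszulWindow (W.kit.atScale L hL).F (hStd E₀ (W.kit.atScale L hL).η) 𝓕 D.mu :=
    hmu ▸ D'.cleanAtSeed_atScale hL W.links hD' hR le_eight_of_mem_koszulWindow
  exact D.seedCheck_of_zeroScheme hE hψ hC0 (W.kit.atScale L hL) hloc hrk hcl one_two_three_mem_koszulWindow.1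
    one_two_three_mem_koszulWindow.2.1 one_two_three_mem_koszulWindow.2.2 s hZ hreg hint hcoh hsr

/-! ### The checkers for the new alphabets, by name -/

variable {𝔠 : MonadAlphabet.CellAlphabet GaussianInt CWord}

/-- **THE SHEAF-SEED CHECKER FOR A PRESENTATION OVER ANY ALPHABET WITH AN INTEGER SHADOW, END TO END**: (A1)-clean, `μ ≠ 0`, realised AT
SCALE `L` by a finite locally free `I`-semiregular `𝓔` ⟹ `HasHyperbolicBFSheafSeedOn C 4 1 I` (through the shadow design). -/
theorem IntShadow.hasHyperbolicBFSheafSeedOn (σ : IntShadow 𝔠) (hE : E₀.dim = 1) (hψ : ψ₀ ≫ ψ₀ = -(1 • 𝟙 E₀))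
    (W : WordKit E₀ ψ₀) (Pr : MonadAlphabet.Presentation 𝔠) (hclean : Pr.Clean) (hμ : Pr.mu ≠ 0) {L : ℕ} (hL : L ≠ 0)
    {𝓔 : (pad4Anchor E₀).X.left.Modules} (hR : RealisesTensorAtScale C W.Φ 𝓔 L Pr.wch) {I : Finset ℕ} (h4 : 4 ∈ I)
    (hI : ∀ p ∈ I, p ≤ 8) (h𝓔 : IsFiniteLocallyFree 𝓔) (hsr : IsISemiregular h𝓔 {q' | q' + 1 ∈ I}) :
    HasHyperbolicBFSheafSeedOn C 4 1 I :=
  Design.hasHyperbolicBFSheafSeedOn_atScale hE hψ W ((σ.clean_design_iff Pr).2 hclean) (by rwa [σ.mu_design]) hL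
    (by rwa [σ.wch_design]) h4 hI h𝓔 hsr

/-- … and for a three-term MONAD design over such an alphabet (class `N − A − C`). -/
theorem IntShadow.hasHyperbolicBFSheafSeedOn_monad (σ : IntShadow 𝔠) (hE : E₀.dim = 1) (hψ : ψ₀ ≫ ψ₀ = -(1 • 𝟙 E₀))
    (W : WordKit E₀ ψ₀) (D : MonadAlphabet.MonadDesign 𝔠) (hclean : D.Clean) (hμ : D.mu ≠ 0) {L : ℕ} (hL : L ≠ 0)
    {𝓔 : (pad4Anchor E₀).X.left.Modules} (hR : RealisesTensorAtScale C W.Φ 𝓔 L D.wch) {I : Finset ℕ} (h4 : 4 ∈ I)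
    (hI : ∀ p ∈ I, p ≤ 8) (h𝓔 : IsFiniteLocallyFree 𝓔) (hsr : IsISemiregular h𝓔 {q' | q' + 1 ∈ I}) :
    HasHyperbolicBFSheafSeedOn C 4 1 I :=
  Design.hasHyperbolicBFSheafSeedOn_atScale hE hψ W ((σ.clean_designM_iff D).2 hclean) (by rwa [σ.mu_designM]) hL
    (by rwa [σ.wch_designM]) h4 hI h𝓔 hsr

/-- **THE SHEAF-SEED CHECKER FOR BOX SEMI-HOMOGENEOUS PRESENTATIONS AT SCALE `L`** (the alphabet the forest searches: semihom-1's
`S′_{1∕2}`-type supports), by name. -/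
theorem hasHyperbolicBFSheafSeedOn_of_boxPresentation (hE : E₀.dim = 1) (hψ : ψ₀ ≫ ψ₀ = -(1 • 𝟙 E₀)) (W : WordKit E₀ ψ₀)
    {L : ℕ} (hL : L ≠ 0) (Pr : MonadAlphabet.Presentation (MonadAlphabet.boxAlphabet L)) (hclean : Pr.Clean) (hμ : Pr.mu ≠ 0)
    {𝓔 : (pad4Anchor E₀).X.left.Modules} (hR : RealisesTensorAtScale C W.Φ 𝓔 L Pr.wch) {I : Finset ℕ} (h4 : 4 ∈ I)
    (hI : ∀ p ∈ I, p ≤ 8) (h𝓔 : IsFiniteLocallyFree 𝓔) (hsr : IsISemiregular h𝓔 {q' | q' + 1 ∈ I}) :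
    HasHyperbolicBFSheafSeedOn C 4 1 I :=
  (IntShadow.box L).hasHyperbolicBFSheafSeedOn hE hψ W Pr hclean hμ hL hR h4 hI h𝓔 hsr

/-- … and for box semi-homogeneous MONAD designs at scale `L`. -/
theorem hasHyperbolicBFSheafSeedOn_of_boxMonadDesign (hE : E₀.dim = 1) (hψ : ψ₀ ≫ ψ₀ = -(1 • 𝟙 E₀)) (W : WordKit E₀ ψ₀)
    {L : ℕ} (hL : L ≠ 0) (D : MonadAlphabet.MonadDesign (MonadAlphabet.boxAlphabet L)) (hclean : D.Clean) (hμ : D.mu ≠ 0)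
    {𝓔 : (pad4Anchor E₀).X.left.Modules} (hR : RealisesTensorAtScale C W.Φ 𝓔 L D.wch) {I : Finset ℕ} (h4 : 4 ∈ I)
    (hI : ∀ p ∈ I, p ≤ 8) (h𝓔 : IsFiniteLocallyFree 𝓔) (hsr : IsISemiregular h𝓔 {q' | q' + 1 ∈ I}) :
    HasHyperbolicBFSheafSeedOn C 4 1 I :=
  (IntShadow.box L).hasHyperbolicBFSheafSeedOn_monad hE hψ W D hclean hμ hL hR h4 hI h𝓔 hsr

/-- **THE SHEAF-SEED CHECKER FOR UNIPOTENT PRESENTATIONS** (scale `1`). -/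
theorem hasHyperbolicBFSheafSeedOn_of_unipPresentation (hE : E₀.dim = 1) (hψ : ψ₀ ≫ ψ₀ = -(1 • 𝟙 E₀)) (W : WordKit E₀ ψ₀)
    (Pr : MonadAlphabet.Presentation MonadAlphabet.unipAlphabet) (hclean : Pr.Clean) (hμ : Pr.mu ≠ 0)
    {𝓔 : (pad4Anchor E₀).X.left.Modules} (hR : RealisesTensor C W.Φ 𝓔 Pr.wch) {I : Finset ℕ} (h4 : 4 ∈ I)
    (hI : ∀ p ∈ I, p ≤ 8) (h𝓔 : IsFiniteLocallyFree 𝓔) (hsr : IsISemiregular h𝓔 {q' | q' + 1 ∈ I}) :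
    HasHyperbolicBFSheafSeedOn C 4 1 I :=
  IntShadow.unip.hasHyperbolicBFSheafSeedOn hE hψ W Pr hclean hμ one_ne_zero (realisesTensorAtScale_one_iff.2 hR) h4 hI h𝓔 hsr

/-- **THE lci ∕ BLOCH DOOR FOR A BOX PRESENTATION AT SCALE `L`, GIVEN THE LAW**: a box presentation `Pr` passing C0 (clean, `μ ≠ 0`,
`ch₀ = 4`, positive multiplicities) whose TWISTED ∕ same-`μ` companion `Pr'` (clean, `μ(Pr') = μ(Pr)`) is realised at scale `L` by a rank-`4`
vector bundle with a section whose zero scheme passes C5–C7 ⟹ the shadow design passes v4's `SeedCheck` on the kit read at scale `L`. -/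
theorem seedCheck_of_boxPresentation_zeroScheme (hE : E₀.dim = 1) (hψ : ψ₀ ≫ ψ₀ = -(1 • 𝟙 E₀)) {L : ℕ} (hL : L ≠ 0)
    (Pr Pr' : MonadAlphabet.Presentation (MonadAlphabet.boxAlphabet L)) (hclean : Pr.Clean) (hμ : Pr.mu ≠ 0)
    (hrk4 : Pr.wch MonadAlphabet.oneWord = 4) (hN : ∀ X ∈ Pr.N, 0 < Pr.mN X) (hP : ∀ X ∈ Pr.P, 0 < Pr.mP X)
    (hclean' : Pr'.Clean) (hmu : Pr'.mu = Pr.mu) (W : WordKit E₀ ψ₀) {𝓕 : (pad4Anchor E₀).X.left.Modules}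
    (hloc : TopChernFourLocalisation C) (hrk : HasRank 𝓕 4) (hR : RealisesTensorAtScale C W.Φ 𝓕 L Pr'.wch)
    (s : Modules.unitModule (pad4Anchor E₀).X.left ⟶ 𝓕) {Z : Scheme.{0}} {i : Z ⟶ (pad4Anchor E₀).X.left}
    (hZ : IsZeroSchemeOf s i) (hreg : IsRegularImmersionOfCodim i 4) (hint : AlgebraicGeometry.IsIntegral Z)
    (hcoh : ∀ z ∈ Set.range i.base, ((4 : ℕ) : ℕ∞) ≤ Order.coheight z) (hsr : IsBlochSemiregular i (2 * 4) 4) :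
    ∃ q : ℚ, ((IntShadow.box L).design Pr).SeedCheck (W.kit.atScale L hL) i q :=
  Design.seedCheck_atScale_of_zeroScheme hE hψ ((IntShadow.box L).classData_design hclean hμ hrk4 hN hP)
    (((IntShadow.box L).clean_design_iff Pr').2 hclean')
    (by rw [(IntShadow.box L).mu_design, (IntShadow.box L).mu_design, hmu]) W hL hloc hrk
    (by rwa [(IntShadow.box L).wch_design]) s hZ hreg hint hcoh hsr

end Doors


/-! ## §24.4 Alphabets WITHOUT an integer shadow (unbalanced letters `gAlph`, blocks B3 ∕ B4): the TENSOR-LEVEL collapse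

For a general cell alphabet on the box frame the json side of C5–C8 reads three things of the class tensor `T = ch(𝓔)`: (A1)
(`ClassScreen T`), `μ = T(eeee) ≠ 0`, and TAMENESS — the e-free coefficients are REAL integers and `T(ēēēē) = conj T(eeee)` — which
integer cells give for free (`Design.mubar_eq_star_mu`) and which is a genuine (decidable) check for a general alphabet: an e-free
coefficient with non-zero imaginary part puts `ch_p ∉ ℚ[h]` and (A1@Z) FAILS honestly. v4's collapse is re-proved at tensor level. -/

section Tame

variable {E₀ : AbelianVariety ℂ} {ψ₀ : E₀ ⟶ E₀} {C : ChernCharacterBetti}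

/-- the e-free coefficient of degree `p` of a tensor: its value on the reference e-free word of that degree (on a clean tensor every
e-free word of degree `p` carries it). -/
def tcoeff (T : CWord → GaussianInt) (p : Fin 9) : GaussianInt := T (refWord p)

/-- **A TAME TENSOR**: real e-free coefficients and `T(ēēēē) = conj T(eeee)`. -/
structure Tame (T : CWord → GaussianInt) : Prop where
  im_tcoeff : ∀ p : Fin 9, (tcoeff T p).im = 0
  ebar : T ebarWord = star (T eWord)

theorem toComplex_tcoeff_of_tame {T : CWord → GaussianInt} (hT : Tame T) (p : Fin 9) :
    GaussianInt.toComplex (tcoeff T p) = (((tcoeff T p).re : ℤ) : ℂ) := by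
  rw [GaussianInt.toComplex_def, hT.im_tcoeff p, Int.cast_zero, zero_mul, add_zero]

/-- for a clean tensor the e-free part of degree `p` is `c_p · Σ_{e-free, deg p} cls p w`. -/
theorem sum_eFree_smul_of_classScreen {T : CWord → GaussianInt} (hT : ClassScreen T) (Φ : WordFrame E₀) (p : Fin 9) :
    ∑ w ∈ eFreeWordsOfDeg p, GaussianInt.toComplex (T w) • Φ.cls p w =
      GaussianInt.toComplex (tcoeff T p) • ∑ w ∈ eFreeWordsOfDeg p, Φ.cls p w := by
  rw [Finset.smul_sum]
  refine Finset.sum_congr rfl fun w hw => ?_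
  obtain ⟨hdeg, hfree⟩ := mem_eFreeWordsOfDeg.1 hw
  rw [tcoeff, hT.2 w (refWord p) hfree (refWord_spec p).1 (hdeg.trans (refWord_spec p).2.symm)]

/-- for a clean tensor the e-mixed part vanishes in degrees `p ≠ 4`. -/
theorem sum_eMixed_eq_zero_of_classScreen {T : CWord → GaussianInt} (hT : ClassScreen T) (Φ : WordFrame E₀) {p : ℕ}
    (hp : p ≠ 4) : ∑ w ∈ (wordsOfDeg p).filter (fun w => ¬ EFree w), GaussianInt.toComplex (T w) • Φ.cls p w = 0 := by
  refine Finset.sum_eq_zero fun w hw => ?_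
  rw [Finset.mem_filter, mem_wordsOfDeg] at hw
  have h1 : w ≠ eWord := fun h => hp (by rw [← hw.1, h]; exact Design.wdeg_eWord)
  have h2 : w ≠ ebarWord := fun h => hp (by rw [← hw.1, h]; exact wdeg_ebarWord)
  rw [hT.1 w hw.2 h1 h2, map_zero, zero_smul]

/-- for a clean tensor the e-mixed part of degree `4` is `T(eeee)·cls₄ eeee + T(ēēēē)·cls₄ ēēēē`. -/
theorem sum_eMixed_four_of_classScreen {T : CWord → GaussianInt} (hT : ClassScreen T) (Φ : WordFrame E₀) :
    ∑ w ∈ (wordsOfDeg 4).filter (fun w => ¬ EFree w), GaussianInt.toComplex (T w) • Φ.cls 4 w =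
      GaussianInt.toComplex (T eWord) • Φ.cls 4 eWord + GaussianInt.toComplex (T ebarWord) • Φ.cls 4 ebarWord := by
  have he : eWord ∈ (wordsOfDeg 4).filter (fun w => ¬ EFree w) :=
    Finset.mem_filter.2 ⟨mem_wordsOfDeg.2 Design.wdeg_eWord, not_eFree_eWord.1⟩
  have heb : ebarWord ∈ (wordsOfDeg 4).filter (fun w => ¬ EFree w) :=
    Finset.mem_filter.2 ⟨mem_wordsOfDeg.2 wdeg_ebarWord, not_eFree_eWord.2.1⟩
  rw [Finset.sum_eq_add_of_mem eWord ebarWord he heb not_eFree_eWord.2.2 fun c hc hne => by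
    rw [hT.1 c (Finset.mem_filter.1 hc).2 hne.1 hne.2, map_zero, zero_smul]]

/-- **(A1) + TAME ⟹ the class a tensor names is `(c_p ∕ p!)·h^p` in degrees `p ≠ 4`** (tensor-level `Design.classOf_wch_of_ne_four`). -/
theorem classOf_of_classScreen_ne_four {T : CWord → GaussianInt} {Φ : WordFrame E₀} {F : WeilFrame E₀ ψ₀}
    {h : complexBetti (pad4Anchor E₀).X 2} (hΦ : Φ.LinksTo F h) (hT : ClassScreen T) (hTt : Tame T) (p : Fin 9)
    (hp : (p : ℕ) ≠ 4) :
    Φ.classOf p T = (((((tcoeff T p).re : ℤ) : ℚ) / ((p : ℕ).factorial : ℚ) : ℚ) : ℂ) • cupPowTwo h p := by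
  rw [WordFrame.classOf_split, sum_eFree_smul_of_classScreen hT Φ p, hΦ.sum_eFree p,
    sum_eMixed_eq_zero_of_classScreen hT Φ hp, add_zero, smul_smul, toComplex_tcoeff_of_tame hTt]
  congr 1
  push_cast
  ring

/-- **(A1) + TAME ⟹ the class a tensor names in degree `4` is `(c₄ ∕ 24)·h⁴ + wOf T(eeee)`** (tensor-level `Design.classOf_wch_four`). -/
theorem classOf_of_classScreen_four {T : CWord → GaussianInt} {Φ : WordFrame E₀} {F : WeilFrame E₀ ψ₀}
    {h : complexBetti (pad4Anchor E₀).X 2} (hΦ : Φ.LinksTo F h) (hT : ClassScreen T) (hTt : Tame T) :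
    Φ.classOf 4 T = (((((tcoeff T 4).re : ℤ) : ℚ) / 24 : ℚ) : ℂ) • cupPowTwo h 4 + F.wOf (T eWord) := by
  have hfree : ∑ w ∈ eFreeWordsOfDeg 4, GaussianInt.toComplex (T w) • Φ.cls 4 w =
      GaussianInt.toComplex (tcoeff T 4) • ∑ w ∈ eFreeWordsOfDeg 4, Φ.cls 4 w := sum_eFree_smul_of_classScreen hT Φ 4
  have hF1 : ∑ w ∈ eFreeWordsOfDeg 4, Φ.cls 4 w = ((Nat.factorial 4 : ℕ) : ℂ)⁻¹ • cupPowTwo h 4 := hΦ.sum_eFree 4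
  rw [WordFrame.classOf_split, sum_eMixed_four_of_classScreen hT Φ, hfree, hF1, toComplex_tcoeff_of_tame hTt, hTt.ebar,
    GaussianInt.toComplex_star, WeilFrame.wOf, hΦ.rOne_eq, hΦ.rTwo_eq, GaussianInt.toComplex_def, smul_smul]
  simp only [map_add, map_mul, map_intCast, Complex.conj_I, Rat.cast_intCast, Rat.cast_div, Rat.cast_ofNat,
    show (Nat.factorial 4 : ℕ) = 24 from rfl, Nat.cast_ofNat]
  module

/-- **THE TENSOR-LEVEL COLLAPSE**: a sheaf realising a CLEAN TAME tensor `T` through a word frame linked to `(F, h)` is (A1)-clean AT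
THE SEED in every window `⊆ {0..8}`, `W`-coordinate `T(eeee)` — (A1@Z) ⟸ (A1) + tame + realisation, for ANY alphabet. -/
theorem cleanAtSeed_of_realisesTensor_tame {T : CWord → GaussianInt} {Φ : WordFrame E₀} {F : WeilFrame E₀ ψ₀}
    {h : complexBetti (pad4Anchor E₀).X 2} {𝓔 : (pad4Anchor E₀).X.left.Modules} (hΦ : Φ.LinksTo F h) (hT : ClassScreen T)
    (hTt : Tame T) (hR : RealisesTensor C Φ 𝓔 T) {I : Finset ℕ} (hI : ∀ p ∈ I, p ≤ 8) : CleanAtSeed C I F h 𝓔 (T eWord) := by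
  refine ⟨fun p => if hp : p < 9 then (((tcoeff T ⟨p, hp⟩).re : ℤ) : ℚ) / ((p.factorial : ℕ) : ℚ) else 0,
    (((tcoeff T 4).re : ℤ) : ℚ) / 24, fun p hpI hp4 => ?_, (hR 4).trans (classOf_of_classScreen_four hΦ hT hTt)⟩
  have hp : p < 9 := Nat.lt_succ_of_le (hI p hpI)
  simp only [dif_pos hp]
  exact (hR ⟨p, hp⟩).trans (classOf_of_classScreen_ne_four hΦ hT hTt ⟨p, hp⟩ hp4)

/-- … and AT SCALE `L`, against `h` itself, in the Weil frame `F ∕ L⁴`. -/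
theorem cleanAtSeed_atScale_of_tame {T : CWord → GaussianInt} {Φ : WordFrame E₀} {F : WeilFrame E₀ ψ₀}
    {h : complexBetti (pad4Anchor E₀).X 2} {𝓔 : (pad4Anchor E₀).X.left.Modules} {L : ℕ} (hL : L ≠ 0) (hΦ : Φ.LinksTo F h)
    (hT : ClassScreen T) (hTt : Tame T) (hR : RealisesTensorAtScale C Φ 𝓔 L T) {I : Finset ℕ} (hI : ∀ p ∈ I, p ≤ 8) :
    CleanAtSeed C I (F.atScale L hL) h 𝓔 (T eWord) := by
  have hcl := cleanAtSeed_smul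
    (cleanAtSeed_of_realisesTensor_tame (hΦ.atScale hL) hT hTt ((realisesTensor_atScale_iff hL).2 hR) hI)
    (Nat.cast_ne_zero.2 hL : (L : ℚ) ≠ 0)
  rwa [smul_smul, ← Rat.cast_mul, natCast_mul_invScale hL, Rat.cast_one, one_smul] at hcl

/-! ### Tame alphabets: the check is automatic for every alphabet of record, `gAlph` included -/

/-- **A TAME CELL ALPHABET** on the box frame: every cell tensor is self-conjugate on e-free words and `ch(X)(ēēēē) = conj ch(X)(eeee)`. -/
def CellTame (𝔠 : MonadAlphabet.CellAlphabet GaussianInt CWord) : Prop :=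
  ∀ X, (∀ w, EFree w → star (𝔠.ch X w) = 𝔠.ch X w) ∧ 𝔠.ch X ebarWord = star (𝔠.ch X eWord)

/-- **A TAME FACTORWISE ALPHABET**: letter vectors self-conjugate off the Weil pair and `φ(ē) = conj φ(e)`. -/
def LetterTame (𝔄 : MonadAlphabet.Alphabet GaussianInt) : Prop :=
  ∀ x, (∀ l : Fin 6, l ≠ 3 → l ≠ 4 → star (𝔄.phi x l) = 𝔄.phi x l) ∧ 𝔄.phi x 4 = star (𝔄.phi x 3)

theorem im_eq_zero_of_star_eq {z : GaussianInt} (h : star z = z) : z.im = 0 := by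
  have h' := congrArg Zsqrtd.im h
  rw [Zsqrtd.im_star] at h'
  omega

/-- Künneth: a tame factorwise alphabet has a tame cell alphabet. -/
theorem cellTame_toCell {𝔄 : MonadAlphabet.Alphabet GaussianInt} (h𝔄 : LetterTame 𝔄) : CellTame 𝔄.toCell := fun X => by
  have h3 : ∀ f, eWord f = 3 := by decide
  have h4 : ∀ f, ebarWord f = 4 := by decide
  have he : ∀ x, 𝔄.phi x 4 = star (𝔄.phi x 3) := fun x => (h𝔄 x).2
  refine ⟨fun w hw => ?_, ?_⟩
  · have hfix : ∀ f, star (𝔄.phi (X f) (w f)) = 𝔄.phi (X f) (w f) := fun f => (h𝔄 (X f)).1 (w f) (hw f).1 (hw f).2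
    simp only [MonadAlphabet.Alphabet.cellCh_apply, star_mul', hfix]
  · simp only [MonadAlphabet.Alphabet.cellCh_apply, h3, h4, star_mul', he]

/-- **presentations over a tame alphabet have tame class tensors** (json side: nothing to check for the alphabets of record). -/
theorem tame_wch_of_cellTame {𝔠 : MonadAlphabet.CellAlphabet GaussianInt CWord} (h𝔠 : CellTame 𝔠)
    (Pr : MonadAlphabet.Presentation 𝔠) : Tame Pr.wch where
  im_tcoeff p := im_eq_zero_of_star_eq (by
    have hs : ∀ X, star (𝔠.ch X (refWord p)) = 𝔠.ch X (refWord p) := fun X => (h𝔠 X).1 _ (refWord_spec p).1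
    simp only [tcoeff, MonadAlphabet.Presentation.wch, Pi.sub_apply, Finset.sum_apply, Pi.smul_apply, star_sub, star_sum,
      star_zsmul, hs])
  ebar := by
    have hb : ∀ X, 𝔠.ch X ebarWord = star (𝔠.ch X eWord) := fun X => (h𝔠 X).2
    simp only [MonadAlphabet.Presentation.wch, Pi.sub_apply, Finset.sum_apply, Pi.smul_apply, star_sub, star_sum, star_zsmul, hb]

/-- monad designs likewise. -/
theorem tame_wch_monad_of_cellTame {𝔠 : MonadAlphabet.CellAlphabet GaussianInt CWord} (h𝔠 : CellTame 𝔠)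
    (D : MonadAlphabet.MonadDesign 𝔠) : Tame D.wch where
  im_tcoeff p := im_eq_zero_of_star_eq (by
    have hs : ∀ X, star (𝔠.ch X (refWord p)) = 𝔠.ch X (refWord p) := fun X => (h𝔠 X).1 _ (refWord_spec p).1
    simp only [tcoeff, MonadAlphabet.MonadDesign.wch, Pi.sub_apply, Finset.sum_apply, Pi.smul_apply, star_sub, star_sum,
      star_zsmul, hs])
  ebar := by
    have hb : ∀ X, 𝔠.ch X ebarWord = star (𝔠.ch X eWord) := fun X => (h𝔠 X).2
    simp only [MonadAlphabet.MonadDesign.wch, Pi.sub_apply, Finset.sum_apply, Pi.smul_apply, star_sub, star_sum, star_zsmul, hb]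

/-- the balanced integer letters are tame (`β̄ = conj β`; `1, α, α, p` integers). -/
theorem letterTame_bLetters : LetterTame MonadAlphabet.bLetters := fun x => by
  refine ⟨fun l hl3 hl4 => ?_, ?_⟩
  · show star (bphi x l) = bphi x l
    fin_cases l <;>
      first
        | exact absurd rfl hl3
        | exact absurd rfl hl4
        | simp [bphi, phiVec, star_intCast]
  · exact bphi_four_eq_star x

/-- **the UNBALANCED letters `gAlph` are tame** (`uphi = (1, α, α′, β, β̄, αα′ − |β|²)`): blocks B3 ∕ B4 have a checker. -/
theorem letterTame_gLetters : LetterTame MonadAlphabet.gLetters := fun x => by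
  refine ⟨fun l hl3 hl4 => ?_, ?_⟩
  · show star (MonadAlphabet.uphi x l) = MonadAlphabet.uphi x l
    fin_cases l <;>
      first
        | exact absurd rfl hl3
        | exact absurd rfl hl4
        | simp [MonadAlphabet.uphi, star_intCast]
  · show MonadAlphabet.uphi x 4 = star (MonadAlphabet.uphi x 3)
    ext <;> simp [MonadAlphabet.uphi]

/-- the box semi-homogeneous letters are tame (`rk · bphi`). -/
theorem letterTame_boxLetters (L : ℕ) : LetterTame (MonadAlphabet.boxLetters L) := fun x => by
  refine ⟨fun l hl3 hl4 => ?_, ?_⟩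
  · show star (((x.rk : ℕ) : GaussianInt) * bphi (x.atScale L) l) = ((x.rk : ℕ) : GaussianInt) * bphi (x.atScale L) l
    rw [star_mul', star_natCast, (letterTame_bLetters (x.atScale L)).1 l hl3 hl4]
  · show ((x.rk : ℕ) : GaussianInt) * bphi (x.atScale L) 4 = star (((x.rk : ℕ) : GaussianInt) * bphi (x.atScale L) 3)
    rw [star_mul', star_natCast, bphi_four_eq_star]

/-- the unipotent letters are tame (`m · bphi`). -/
theorem letterTame_unipLetters : LetterTame MonadAlphabet.unipLetters := fun x => by
  refine ⟨fun l hl3 hl4 => ?_, ?_⟩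
  · show star (((x.m : ℕ) : GaussianInt) * bphi x.pt l) = ((x.m : ℕ) : GaussianInt) * bphi x.pt l
    rw [star_mul', star_natCast, (letterTame_bLetters x.pt).1 l hl3 hl4]
  · show ((x.m : ℕ) : GaussianInt) * bphi x.pt 4 = star (((x.m : ℕ) : GaussianInt) * bphi x.pt 3)
    rw [star_mul', star_natCast, bphi_four_eq_star]

theorem cellTame_gAlph : CellTame MonadAlphabet.gAlph := cellTame_toCell letterTame_gLetters

theorem cellTame_bAlph : CellTame MonadAlphabet.bAlph := cellTame_toCell letterTame_bLetters

theorem cellTame_boxAlphabet (L : ℕ) : CellTame (MonadAlphabet.boxAlphabet L) := cellTame_toCell (letterTame_boxLetters L)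

theorem cellTame_unipAlphabet : CellTame MonadAlphabet.unipAlphabet := cellTame_toCell letterTame_unipLetters

/-! ### The doors for presentations over ANY tame alphabet -/

/-- **THE SHEAF-SEED CHECKER FOR A PRESENTATION OVER ANY TAME ALPHABET, END TO END** (no integer shadow needed): (A1)-clean,
`μ ≠ 0`, realised at scale `L` by a finite locally free `I`-semiregular `𝓔` ⟹ `HasHyperbolicBFSheafSeedOn C 4 1 I`. -/
theorem hasHyperbolicBFSheafSeedOn_of_tamePresentation {𝔠 : MonadAlphabet.CellAlphabet GaussianInt CWord} (h𝔠 : CellTame 𝔠)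
    (hE : E₀.dim = 1) (hψ : ψ₀ ≫ ψ₀ = -(1 • 𝟙 E₀)) (W : WordKit E₀ ψ₀) (Pr : MonadAlphabet.Presentation 𝔠)
    (hclean : Pr.Clean) (hμ : Pr.mu ≠ 0) {L : ℕ} (hL : L ≠ 0) {𝓔 : (pad4Anchor E₀).X.left.Modules}
    (hR : RealisesTensorAtScale C W.Φ 𝓔 L Pr.wch) {I : Finset ℕ} (h4 : 4 ∈ I) (hI : ∀ p ∈ I, p ≤ 8)
    (h𝓔 : IsFiniteLocallyFree 𝓔) (hsr : IsISemiregular h𝓔 {q' | q' + 1 ∈ I}) : HasHyperbolicBFSheafSeedOn C 4 1 I :=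
  hasHyperbolicBFSheafSeedOn_of_cleanAtSeed_hStd hE hψ (W.kit.atScale L hL) hμ h4 h𝓔 hsr
    (cleanAtSeed_atScale_of_tame hL W.links hclean (tame_wch_of_cellTame h𝔠 Pr) hR hI)

/-- … for MONAD designs over any tame alphabet. -/
theorem hasHyperbolicBFSheafSeedOn_of_tameMonadDesign {𝔠 : MonadAlphabet.CellAlphabet GaussianInt CWord} (h𝔠 : CellTame 𝔠)
    (hE : E₀.dim = 1) (hψ : ψ₀ ≫ ψ₀ = -(1 • 𝟙 E₀)) (W : WordKit E₀ ψ₀) (D : MonadAlphabet.MonadDesign 𝔠)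
    (hclean : D.Clean) (hμ : D.mu ≠ 0) {L : ℕ} (hL : L ≠ 0) {𝓔 : (pad4Anchor E₀).X.left.Modules}
    (hR : RealisesTensorAtScale C W.Φ 𝓔 L D.wch) {I : Finset ℕ} (h4 : 4 ∈ I) (hI : ∀ p ∈ I, p ≤ 8)
    (h𝓔 : IsFiniteLocallyFree 𝓔) (hsr : IsISemiregular h𝓔 {q' | q' + 1 ∈ I}) : HasHyperbolicBFSheafSeedOn C 4 1 I :=
  hasHyperbolicBFSheafSeedOn_of_cleanAtSeed_hStd hE hψ (W.kit.atScale L hL) hμ h4 h𝓔 hsr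
    (cleanAtSeed_atScale_of_tame hL W.links hclean (tame_wch_monad_of_cellTame h𝔠 D) hR hI)

/-- **the unbalanced alphabet `gAlph` (blocks B3 ∕ B4), by name.** -/
theorem hasHyperbolicBFSheafSeedOn_of_gPresentation (hE : E₀.dim = 1) (hψ : ψ₀ ≫ ψ₀ = -(1 • 𝟙 E₀)) (W : WordKit E₀ ψ₀)
    (Pr : MonadAlphabet.Presentation MonadAlphabet.gAlph) (hclean : Pr.Clean) (hμ : Pr.mu ≠ 0) {L : ℕ} (hL : L ≠ 0)
    {𝓔 : (pad4Anchor E₀).X.left.Modules} (hR : RealisesTensorAtScale C W.Φ 𝓔 L Pr.wch) {I : Finset ℕ} (h4 : 4 ∈ I)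
    (hI : ∀ p ∈ I, p ≤ 8) (h𝓔 : IsFiniteLocallyFree 𝓔) (hsr : IsISemiregular h𝓔 {q' | q' + 1 ∈ I}) :
    HasHyperbolicBFSheafSeedOn C 4 1 I :=
  hasHyperbolicBFSheafSeedOn_of_tamePresentation cellTame_gAlph hE hψ W Pr hclean hμ hL hR h4 hI h𝓔 hsr

/-- **(σ) OBJECT HALF FOR A TAME PRESENTATION FROM A ZERO SCHEME, AT SCALE `L`** (kit-level, design-free; v4 `supported_symH_of_zeroScheme`
on the kit read at scale `L`, GIVEN the law): `∃ q, ClassCheck (K.atScale L) μ i q` — with C5–C7 of `i` this is a `SeedCertificate`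
(`certificate_of_tamePresentation_zeroScheme`) and feeds `seedData_of_certificate` ∕ `blochSeedDiscOne_of_certificates` unchanged. -/
theorem classCheck_of_tamePresentation_zeroScheme {𝔠 : MonadAlphabet.CellAlphabet GaussianInt CWord} (h𝔠 : CellTame 𝔠)
    (hE : E₀.dim = 1) (hψ : ψ₀ ≫ ψ₀ = -(1 • 𝟙 E₀)) (W : WordKit E₀ ψ₀) (Pr : MonadAlphabet.Presentation 𝔠)
    (hclean : Pr.Clean) (hμ : Pr.mu ≠ 0) {L : ℕ} (hL : L ≠ 0) {𝓕 : (pad4Anchor E₀).X.left.Modules}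
    (hloc : TopChernFourLocalisation C) (hrk : HasRank 𝓕 4) (hR : RealisesTensorAtScale C W.Φ 𝓕 L Pr.wch)
    (s : Modules.unitModule (pad4Anchor E₀).X.left ⟶ 𝓕) {Z : Scheme.{0}} {i : Z ⟶ (pad4Anchor E₀).X.left}
    (hZ : IsZeroSchemeOf s i) : ∃ q : ℚ, ClassCheck (W.kit.atScale L hL) Pr.mu i q := by
  obtain ⟨q, hq⟩ := supported_symH_of_zeroScheme hE hψ (W.kit.atScale L hL) hloc hrk
    (cleanAtSeed_atScale_of_tame hL W.links hclean (tame_wch_of_cellTame h𝔠 Pr) hR le_eight_of_mem_koszulWindow)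
    one_two_three_mem_koszulWindow.1 one_two_three_mem_koszulWindow.2.1 one_two_three_mem_koszulWindow.2.2 s hZ
  exact ⟨q, hμ, hq⟩

/-- … packaged with C5–C7 of the zero scheme as a `SeedCertificate` on the kit read at scale `L`. -/
def certificate_of_classCheck (K : AnchorKit E₀ ψ₀) {μ : GaussianInt} {Z : Scheme.{0}} {i : Z ⟶ (pad4Anchor E₀).X.left}
    {q : ℚ} (hcc : ClassCheck K μ i q) (hci : IsClosedImmersion i) (hreg : IsRegularImmersionOfCodim i 4)
    (hint : AlgebraicGeometry.IsIntegral Z) (hcoh : ∀ z ∈ Set.range i.base, ((4 : ℕ) : ℕ∞) ≤ Order.coheight z)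
    (hsr : IsBlochSemiregular i (2 * 4) 4) : SeedCertificate E₀ ψ₀ :=
  ⟨K, μ, hcc.1, Z, i, q, hci, hreg, hint, hcoh, hsr, hcc.2⟩

end Tame

/-! ## Audit: nothing is decided here

Every door theorem carries its realisation ∕ semiregularity ∕ zero-scheme data (and, for the lci door, v4's `TopChernFourLocalisation`
law) among its hypotheses; `WeilFrame.smulQ`, `AnchorKit.smulW ∕ atScale`, `WordFrame.rescale ∕ atScale`, `IntShadow` and the shadow
designs are definitions BUILT FROM GIVEN DATA (no existence asserted); `RealisesTensorAtScale` is a predicate. No `instance`, no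
`notation`, no named fact, 0 `sorry`. -/

end Summit.HodgeConjecture.HodgeConjecture.Cruxes.BlochSeedDiscOne.SeedChecker

end
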